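import Literature.NumberTheory.EllipticCurves.BinaryQuarticStabilizer
import Literature.GroupTheory.Index.CosetsOverOrbits
import Mathlib.LinearAlgebra.Matrix.GeneralLinearGroup.Basic
import HarnessLib

/-!
# Bhargava–Shankar's weights `m(f) = Σ_{f' ∈ B(f)} #Aut_ℚ(f')/#Aut_ℤ(f')` and
# `m_p(f) = Σ_{f' ∈ B_p(f)} #Aut_{ℚ_p}(f')/#Aut_{ℤ_p}(f')` on integral binary quartic forms

Topic `Literature/NumberTheory/EllipticCurves`; companion of `BinaryQuarticForms.lean` (the space
`V_R` of binary quartic forms) and `BinaryQuarticStabilizer.lean` (the twisted action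
`γ · f = (det γ)⁻² f((x,y)γ)` of `GL₂(K)` on `V_K`, under which the scalars act trivially, and the
order `pgl2StabilizerCard f = #Stab_{PGL₂(K)}(f)` of the stabiliser).

Source: M. Bhargava, A. Shankar, *Binary quartic forms having bounded invariants, and the
boundedness of the average rank of elliptic curves*, Ann. of Math. (2) 181 (2015) 191–242, §3.2 of
the published version (= `arXiv:1006.1002v3`; this material is not in the held `v2` text, whose §5
uses the unweighted set `S^F` instead — see the concordance in
`BhargavaShankarEq31FrontierProofs.lean`, §2–3 of its module docstring). There, in order to count
`PGL₂(ℚ)`-equivalence classes of locally soluble integral forms by counting `PGL₂(ℤ)`-orbits, each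
orbit `PGL₂(ℤ) · f` is weighted by `1/m(f)` with

  `m(f) := Σ_{f' ∈ B(f)} #Aut_ℚ(f') / #Aut_ℤ(f')`,

"where `B(f)` denotes a set of representatives for the action of `PGL₂(ℤ)` on the
`PGL₂(ℚ)`-equivalence class of `f` in `V_ℤ`, and `Aut_ℚ(f')` (resp. `Aut_ℤ(f')`) denotes the
stabilizer of `f'` in `PGL₂(ℚ)` (resp. `PGL₂(ℤ)`)"; and likewise
`m_p(f) := Σ_{f' ∈ B_p(f)} #Aut_{ℚ_p}(f') / #Aut_{ℤ_p}(f')` with `B_p(f)` a set of representatives for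
the action of `PGL₂(ℤ_p)` on the `PGL₂(ℚ_p)`-equivalence class of `f` in `V_{ℤ_p}` — so that
`m(f) = ∏_p m_p(f)` (Prop. 3.6 of the published version; companion file
`BhargavaShankarWeightProductProofs.lean`). The same weights, for a general pair `G(ℤ) ⊂ G(ℚ)`,
are eq. (37), (40) and Prop. 4.16 of A. Shankar, X. Wang, *Average size of the 2-Selmer group of
Jacobians of monic even hyperelliptic curves* (arXiv:1307.3531), whose proof of `w = ∏ w_p` is
"identical to that of [BS, Prop. 3.6]".

## Contents

Everything is set up for a ring map `φ : R →+* K` into a field (instances `ℤ → ℚ`, `ℤ_p → ℚ_p`):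

* `BinaryQuartic.instMulActionGL` (scoped instance): **the twisted action of `GL₂(K)` on `V_K`** as a
  Mathlib `MulAction`, `g • f = twist ↑g f`; the centre `Z(GL₂(K)) = Kˣ · 1` (Mathlib's
  `Matrix.GeneralLinearGroup.center_eq_range_scalar`) acts trivially (`center_le_stabilizer`), so
  this is the action of `PGL₂(K) = GL₂(K)/Kˣ`.
* `BinaryQuartic.integralUpToScalars φ = Kˣ · GL₂(R) ≤ GL₂(K)`, the preimage of
  `PGL₂(R) ≤ PGL₂(K)`; `BinaryQuartic.integralForms φ = V_R ⊆ V_K`, which is stable under it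
  (`smul_mem_integralForms`).
* `#Aut_K(f) = [Stab_{GL₂(K)}(f) : Kˣ]` **is the tree's `pgl2StabilizerCard f`**
  (`relIndex_center_stabilizer`), `#Aut_R(f) = [Stab_{GL₂(K)}(f) ∩ Kˣ·GL₂(R) : Kˣ]`
  (`autIntCard φ f`), and the summand `#Aut_K(f)/#Aut_R(f)` of `m` is the index
  `BinaryQuartic.autIndex φ f = [Stab_{GL₂(K)}(f) : Stab_{GL₂(K)}(f) ∩ Kˣ·GL₂(R)]`
  (`autIndex_mul_autIntCard : autIndex · #Aut_R = #Aut_K`).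
* `BinaryQuartic.weight φ f = Σ_{O} autIndex φ (r O)` — **the printed weight**, the sum over the
  `PGL₂(R)`-orbits `O` in the `PGL₂(K)`-class of `f` inside `V_R` of `#Aut_K/#Aut_R` of a
  representative (`weight_eq_finsum_of_representatives`: any representatives give the same sum);
  `BinaryQuartic.globalWeight f = m(f)` (`R = ℤ`, `K = ℚ`) and
  `BinaryQuartic.localWeight f = m_p(f)` (`R = ℤ_p`, `K = ℚ_p`; `localWeightAt p f` for `f ∈ V_ℤ`).
* **`weight φ f = #{cosets Kˣ·GL₂(R)·g : g ∈ GL₂(K), g · f ∈ V_R}`** (`weight_eq_ncard_cosets`, from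
  the mass formula of `Literature.GroupTheory.Index.CosetsOverOrbits`): the form of `m`, `m_p` in
  which Prop. 3.6 becomes the class-number-one property of `PGL₂`; and `weight = #orbits` exactly
  when all the `Aut_K(f')` come from `PGL₂(R)` (`weight_eq_ncard_intClassOrbits_iff`), in particular when
  they are trivial — the comparison "`m(f) = n(f)` unless some `f' ∈ B(f)` has a nontrivial
  stabilizer in `PGL₂(ℚ)`" of §3.2.

No named facts; all statements proved. What is NOT here: `m(f) = ∏_p m_p(f)` (companion file) and
the finiteness of the coset sets (proved there for `Δ(f) ≠ 0` over `ℚ_p`, and deduced over `ℚ`).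

## References

* M. Bhargava, A. Shankar, Ann. of Math. (2) 181 (2015) 191–242, §3.2 and Prop. 3.6 of the
  published version (= arXiv:1006.1002v3). [cite: BhargavaShankarAnnals2015, §3.2 (weights m, m_p; published numbering)]
* A. Shankar, X. Wang, *Average size of the 2-Selmer group of Jacobians of monic even hyperelliptic
  curves*, Compos. Math. 154 (2018) = arXiv:1307.3531, eq. (37), (40), Prop. 4.16 (materialised:
  galaxy pdf 3773519613210674100, pp. 30–31).

## Design

* The groups are Mathlib's `GL (Fin 2) K = (Matrix (Fin 2) (Fin 2) K)ˣ`. Mathlib's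
  `Matrix.ProjGenLinGroup` (`PGL(2, K) = GL₂(K) ⧸ Z`) is not used: all subgroups considered here
  contain the centre `Z = Kˣ`, so cosets, orbits and indices in `GL₂(K)` relative to `Kˣ·GL₂(R)`
  *are* those of `PGL₂(K)` relative to `PGL₂(R)`, while the tree's API (`twist`, `stabilizerSet`,
  `pgl2StabilizerCard`, the Cartan decomposition, class number one) is stated for matrices.
* The `MulAction` instance is `scoped` (namespace `Literature.NumberTheory.EllipticCurves.BinaryQuartic`)
  since `BinaryQuartic K` also carries the untwisted substitution action.
* "A set of representatives `B(f)`" is rendered by summing an orbit-invariant quantity over the set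
  of orbits (`weight`), together with the statement that any representatives may be used.
* Indices are `Subgroup.relIndex` (value `0` if infinite), counts are `Set.ncard`.
-/

noncomputable section

open scoped Classical
open Matrix MulAction Literature.GroupTheory.Index

namespace Literature.NumberTheory.EllipticCurves

namespace BinaryQuartic

variable {K : Type*} [Field K]

/-! ## The twisted action of `GL₂(K)` as a `MulAction` -/

/-- **The twisted action `g · f = (det g)⁻² f((x,y)g)` of `GL₂(K)` on binary quartic forms**, as a
`MulAction` of Mathlib's `GL (Fin 2) K` (Bhargava–Shankar: the action for which `I`, `J` are
invariant and `PGL₂(K)`-equivalence is defined). Scoped instance.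
[cite: BhargavaShankarAnnals2015, §3.2 (published numbering)] -/
scoped instance instMulActionGL : MulAction (GL (Fin 2) K) (BinaryQuartic K) where
  smul g f := twist (g : Matrix (Fin 2) (Fin 2) K) f
  one_smul f := show twist ((1 : GL (Fin 2) K) : Matrix (Fin 2) (Fin 2) K) f = f by
    rw [Units.val_one, twist_one]
  mul_smul g h f := show twist ((g * h : GL (Fin 2) K) : Matrix (Fin 2) (Fin 2) K) f =
      twist (g : Matrix (Fin 2) (Fin 2) K) (twist (h : Matrix (Fin 2) (Fin 2) K) f) by
    rw [Units.val_mul, twist_mul]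

/-- `g • f = twist ↑g f`. [folklore] -/
theorem gl_smul_def (g : GL (Fin 2) K) (f : BinaryQuartic K) :
    g • f = twist (g : Matrix (Fin 2) (Fin 2) K) f := rfl

/-- An element of `GL₂(K)` has nonzero determinant. [folklore] -/
theorem det_coe_ne_zero (g : GL (Fin 2) K) : (g : Matrix (Fin 2) (Fin 2) K).det ≠ 0 := by
  rw [← Matrix.GeneralLinearGroup.val_det_apply]
  exact Units.ne_zero _

/-- The orbit of `f` under `GL₂(K)` is its `PGL₂(K)`-equivalence class (`BinaryQuartic.PGL2Equiv`).
[cite: BhargavaShankarAnnals2015, §3.2 (published numbering)] -/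
theorem mem_orbit_iff_pgl2Equiv (f g : BinaryQuartic K) :
    g ∈ orbit (GL (Fin 2) K) f ↔ PGL2Equiv f g := by
  constructor
  · rintro ⟨γ, rfl⟩
    exact ⟨γ, det_coe_ne_zero γ, rfl⟩
  · rintro ⟨γ, hγ, rfl⟩
    exact ⟨Matrix.GeneralLinearGroup.mkOfDetNeZero γ hγ, rfl⟩

/-! ## Scalars: the centre of `GL₂(K)` -/

/-- Membership in the centre `Z(GL₂(K)) = Kˣ · 1` (Mathlib:
`Matrix.GeneralLinearGroup.center_eq_range_scalar`): `↑g = c • 1` with `c ≠ 0`. [folklore] -/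
theorem mem_center_iff_exists_smul_one (g : GL (Fin 2) K) :
    g ∈ Subgroup.center (GL (Fin 2) K) ↔
      ∃ c : K, c ≠ 0 ∧ (g : Matrix (Fin 2) (Fin 2) K) = c • (1 : Matrix (Fin 2) (Fin 2) K) := by
  rw [Matrix.GeneralLinearGroup.center_eq_range_scalar]
  constructor
  · rintro ⟨c, rfl⟩
    refine ⟨(c : K), c.ne_zero, ?_⟩
    rw [Matrix.GeneralLinearGroup.coe_scalar, Matrix.scalar_apply, Matrix.smul_one_eq_diagonal]
  · rintro ⟨c, hc, hg⟩
    refine ⟨Units.mk0 c hc, Units.ext ?_⟩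
    rw [Matrix.GeneralLinearGroup.coe_scalar, Matrix.scalar_apply, hg, Matrix.smul_one_eq_diagonal]
    rfl

/-- Scalars act trivially: `Z(GL₂(K)) ≤ Stab(f)`, so the twisted action is an action of
`PGL₂(K) = GL₂(K)/Kˣ`. [folklore] -/
theorem center_le_stabilizer (f : BinaryQuartic K) :
    Subgroup.center (GL (Fin 2) K) ≤ stabilizer (GL (Fin 2) K) f := by
  intro g hg
  obtain ⟨c, hc, hg⟩ := (mem_center_iff_exists_smul_one g).mp hg
  rw [mem_stabilizer_iff, gl_smul_def, hg, twist_smul hc, twist_one]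

/-! ## `Kˣ · GL₂(R)` and the integral forms -/

section Integral

variable {R : Type*} [CommRing R] (φ : R →+* K)

/-- **`Kˣ · GL₂(R) ≤ GL₂(K)`**: the invertible matrices some nonzero scalar multiple of which is the
image of a matrix of `GL₂(R)` — the preimage in `GL₂(K)` of `PGL₂(R) ≤ PGL₂(K)` (for `ℤ ⊂ ℚ`:
of `PGL₂(ℤ)`; for `ℤ_p ⊂ ℚ_p`: of `PGL₂(ℤ_p)`). [cite: BhargavaShankarAnnals2015, §3.2 (PGL₂(ℤ), PGL₂(ℤ_p); published numbering)] -/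
def integralUpToScalars : Subgroup (GL (Fin 2) K) where
  carrier := {g | ∃ (c : K) (k : Matrix (Fin 2) (Fin 2) R), c ≠ 0 ∧ IsUnit k.det ∧
    (g : Matrix (Fin 2) (Fin 2) K) = c • k.map φ}
  one_mem' := ⟨1, 1, one_ne_zero, by simp, by simp [Matrix.map_one]⟩
  mul_mem' := by
    rintro g h ⟨c, k, hc, hk, hg⟩ ⟨c', k', hc', hk', hh⟩
    refine ⟨c * c', k * k', mul_ne_zero hc hc', ?_, ?_⟩
    · rw [Matrix.det_mul]; exact hk.mul hk'
    · rw [Units.val_mul, hg, hh, Matrix.map_mul, Matrix.smul_mul, Matrix.mul_smul, smul_smul]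
  inv_mem' := by
    rintro g ⟨c, k, hc, hk, hg⟩
    refine ⟨c⁻¹, k⁻¹, inv_ne_zero hc, Matrix.isUnit_nonsing_inv_det k hk, ?_⟩
    rw [Matrix.coe_units_inv, hg]
    refine Matrix.inv_eq_left_inv ?_
    rw [Matrix.smul_mul, Matrix.mul_smul, smul_smul, ← Matrix.map_mul, Matrix.nonsing_inv_mul k hk,
      Matrix.map_one _ (map_zero φ) (map_one φ), inv_mul_cancel₀ hc, one_smul]

/-- Unfolding of `integralUpToScalars`. [folklore] -/
theorem mem_integralUpToScalars_iff (g : GL (Fin 2) K) :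
    g ∈ integralUpToScalars φ ↔ ∃ (c : K) (k : Matrix (Fin 2) (Fin 2) R), c ≠ 0 ∧ IsUnit k.det ∧
      (g : Matrix (Fin 2) (Fin 2) K) = c • k.map φ := Iff.rfl

/-- `Z(GL₂(K)) = Kˣ ≤ Kˣ · GL₂(R)`. [folklore] -/
theorem center_le_integralUpToScalars : Subgroup.center (GL (Fin 2) K) ≤ integralUpToScalars φ := by
  intro g hg
  obtain ⟨c, hc, hg⟩ := (mem_center_iff_exists_smul_one g).mp hg
  exact ⟨c, 1, hc, by simp, by rw [hg, Matrix.map_one _ (map_zero φ) (map_one φ)]⟩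

/-- The image of `GL₂(R)` lies in `Kˣ · GL₂(R)`. [folklore] -/
theorem mem_integralUpToScalars_of_eq_map {g : GL (Fin 2) K} {k : Matrix (Fin 2) (Fin 2) R}
    (hk : IsUnit k.det) (hg : (g : Matrix (Fin 2) (Fin 2) K) = k.map φ) : g ∈ integralUpToScalars φ :=
  ⟨1, k, one_ne_zero, hk, by rw [hg, one_smul]⟩

/-- The integral forms `V_R ⊆ V_K`. [cite: BhargavaShankarAnnals2015, §3.2 (V_ℤ ⊂ V_ℚ; published numbering)] -/
def integralForms : Set (BinaryQuartic K) := Set.range (BinaryQuartic.map φ)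

/-- Unfolding of `integralForms`. [folklore] -/
theorem mem_integralForms_iff (f : BinaryQuartic K) :
    f ∈ integralForms φ ↔ ∃ f₀ : BinaryQuartic R, f₀.map φ = f := Iff.rfl

/-- `f₀.map φ` is integral. [folklore] -/
theorem map_mem_integralForms (f₀ : BinaryQuartic R) : f₀.map φ ∈ integralForms φ := ⟨f₀, rfl⟩

/-- The twisted action of (the image of) a matrix `k ∈ GL₂(R)` preserves integrality:
`k · f₀ = (u² · f₀((x,y)k))` with `u = (det k)⁻¹ ∈ R`. [folklore] -/
theorem twist_map_map_eq {k : Matrix (Fin 2) (Fin 2) R} {u : R} (hu : k.det * u = 1) (f₀ : BinaryQuartic R) :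
    twist (k.map φ) (f₀.map φ) = ((u ^ 2) • f₀.subst k).map φ := by
  have hdet : (k.map φ).det = φ k.det := by
    rw [← RingHom.mapMatrix_apply, ← RingHom.map_det]
  have hu' : φ k.det * φ u = 1 := by rw [← map_mul, hu, map_one]
  have hinv : ((φ k.det) ^ 2)⁻¹ = (φ u) ^ 2 := by
    rw [← inv_pow, ← eq_inv_of_mul_eq_one_right hu']
  rw [twist, hdet, hinv, ← map_subst, ← map_pow]
  ext <;> simp [map]

/-- **`V_R` is stable under `Kˣ · GL₂(R)`.** [cite: BhargavaShankarAnnals2015, §3.2 (published numbering)] -/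
theorem smul_mem_integralForms {g : GL (Fin 2) K} (hg : g ∈ integralUpToScalars φ) {f : BinaryQuartic K}
    (hf : f ∈ integralForms φ) : g • f ∈ integralForms φ := by
  obtain ⟨c, k, hc, hk, hgk⟩ := hg
  obtain ⟨f₀, rfl⟩ := hf
  obtain ⟨u, hu⟩ := hk.exists_right_inv
  rw [gl_smul_def, hgk, twist_smul hc, twist_map_map_eq φ hu]
  exact map_mem_integralForms φ _

/-- `V_R` is `Kˣ · GL₂(R)`-stable in the sense of `Literature.GroupTheory.Index.IsStableUnder`. [folklore] -/
theorem isStableUnder_integralForms : IsStableUnder (integralUpToScalars φ) (integralForms φ) :=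
  fun _ hg _ hf ↦ smul_mem_integralForms φ hg hf

/-! ## `#Aut_K(f)`, `#Aut_R(f)` and the index `#Aut_K(f)/#Aut_R(f)` -/

omit φ in
/-- The quotient `Stab_{GL₂(K)}(f)/Kˣ` is in bijection with the tree's set of classes of stabilising
matrices modulo scalars (`stabilizerClass f '' stabilizerSet f`). [folklore] -/
theorem exists_equiv_quotient_stabilizerClass (f : BinaryQuartic K) :
    Nonempty (stabilizer (GL (Fin 2) K) f ⧸ (Subgroup.center (GL (Fin 2) K)).subgroupOf (stabilizer (GL (Fin 2) K) f) ≃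
      (stabilizerClass f '' stabilizerSet f)) := by
  set S := stabilizer (GL (Fin 2) K) f
  set N := (Subgroup.center (GL (Fin 2) K)).subgroupOf S
  have hmemS : ∀ s : S, ((s : GL (Fin 2) K) : Matrix (Fin 2) (Fin 2) K) ∈ stabilizerSet f := fun s ↦
    ⟨det_coe_ne_zero _, mem_stabilizer_iff.mp s.2⟩
  -- the map `s ↦ class of ↑s`
  let F : S → stabilizerClass f '' stabilizerSet f := fun s ↦ ⟨stabilizerClass f (s : GL (Fin 2) K), _, hmemS s, rfl⟩
  have hF : ∀ s t : S, (QuotientGroup.leftRel N) s t → F s = F t := by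
    intro s t hst
    rw [QuotientGroup.leftRel_apply, Subgroup.mem_subgroupOf] at hst
    obtain ⟨c, hc, hct⟩ := (mem_center_iff_exists_smul_one _).mp hst
    have ht : ((t : GL (Fin 2) K) : Matrix (Fin 2) (Fin 2) K) = c • ((s : GL (Fin 2) K) : Matrix (Fin 2) (Fin 2) K) := by
      have : (t : GL (Fin 2) K) = (s : GL (Fin 2) K) * ((s : GL (Fin 2) K)⁻¹ * t) := by group
      rw [this, Units.val_mul]
      change ((s : GL (Fin 2) K) : Matrix (Fin 2) (Fin 2) K) * (((s⁻¹ * t : S) : GL (Fin 2) K) : Matrix (Fin 2) (Fin 2) K) = _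
      rw [hct, Matrix.mul_smul, Matrix.mul_one]
    apply Subtype.ext
    change stabilizerClass f _ = stabilizerClass f _
    rw [ht, stabilizerClass_smul f hc]
  refine ⟨Equiv.ofBijective (Quotient.lift F hF) ⟨?_, ?_⟩⟩
  · rintro ⟨s⟩ ⟨t⟩ hst
    change F s = F t at hst
    have hst' : stabilizerClass f ((s : GL (Fin 2) K) : Matrix (Fin 2) (Fin 2) K) =
        stabilizerClass f ((t : GL (Fin 2) K) : Matrix (Fin 2) (Fin 2) K) := congrArg Subtype.val hst
    obtain ⟨c, hc, hct⟩ := exists_smul_of_stabilizerClass_eq (hmemS t) hst'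
    have hmem : s⁻¹ * t ∈ N := by
      rw [Subgroup.mem_subgroupOf, mem_center_iff_exists_smul_one]
      refine ⟨c, hc, ?_⟩
      have hs : IsUnit ((s : GL (Fin 2) K) : Matrix (Fin 2) (Fin 2) K).det :=
        isUnit_iff_ne_zero.mpr (det_coe_ne_zero _)
      change (((s : GL (Fin 2) K)⁻¹ * (t : GL (Fin 2) K) : GL (Fin 2) K) : Matrix (Fin 2) (Fin 2) K) = _
      rw [Units.val_mul, Matrix.coe_units_inv, hct, Matrix.mul_smul, Matrix.nonsing_inv_mul _ hs]
    exact Quotient.sound (QuotientGroup.leftRel_apply.mpr hmem)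
  · rintro ⟨_, γ, hγ, rfl⟩
    refine ⟨Quotient.mk _ ⟨Matrix.GeneralLinearGroup.mkOfDetNeZero γ hγ.1, mem_stabilizer_iff.mpr hγ.2⟩, ?_⟩
    rfl

omit φ in
/-- **`#Aut_K(f) = [Stab_{GL₂(K)}(f) : Kˣ]` is the tree's `pgl2StabilizerCard f`** (the order of
the stabiliser of `f` in `PGL₂(K)`; both are `0` when infinite). [cite: BhargavaShankarAnnals2015, §3.2 (Aut_ℚ(f); published numbering)] -/
theorem relIndex_center_stabilizer (f : BinaryQuartic K) :
    (Subgroup.center (GL (Fin 2) K)).relIndex (stabilizer (GL (Fin 2) K) f) = pgl2StabilizerCard f := by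
  obtain ⟨e⟩ := exists_equiv_quotient_stabilizerClass f
  rw [Subgroup.relIndex, Subgroup.index, Nat.card_congr e, Nat.card_coe_set_eq]
  rfl

/-- `#Aut_R(f) = [Stab_{GL₂(K)}(f) ∩ Kˣ·GL₂(R) : Kˣ]`: the order of the stabiliser of `f ∈ V_K` in
`PGL₂(R)` (Bhargava–Shankar's `Aut_ℤ(f')`, `Aut_{ℤ_p}(f')`; `0` if infinite).
[cite: BhargavaShankarAnnals2015, §3.2 (Aut_ℤ(f'); published numbering)] -/
def autIntCard (f : BinaryQuartic K) : ℕ :=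
  (Subgroup.center (GL (Fin 2) K)).relIndex (stabilizer (GL (Fin 2) K) f ⊓ integralUpToScalars φ)

/-- **The summand `#Aut_K(f)/#Aut_R(f)` of `m(f)`**, as the index
`[Stab_{GL₂(K)}(f) : Stab_{GL₂(K)}(f) ∩ Kˣ·GL₂(R)] = [Aut_K(f) : Aut_R(f)]` (`0` if infinite).
[cite: BhargavaShankarAnnals2015, §3.2 (#Aut_ℚ(f′)/#Aut_ℤ(f′); published numbering)] -/
def autIndex (f : BinaryQuartic K) : ℕ :=
  (integralUpToScalars φ).relIndex (stabilizer (GL (Fin 2) K) f)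

/-- `autIndex · #Aut_R = #Aut_K`: the index is the printed ratio `#Aut_K(f)/#Aut_R(f)`.
[cite: BhargavaShankarAnnals2015, §3.2 (published numbering)] -/
theorem autIndex_mul_autIntCard (f : BinaryQuartic K) :
    autIndex φ f * autIntCard φ f = pgl2StabilizerCard f := by
  rw [autIndex, autIntCard, ← relIndex_center_stabilizer, mul_comm, inf_comm,
    ← Subgroup.inf_relIndex_right (integralUpToScalars φ) (stabilizer (GL (Fin 2) K) f)]
  exact Subgroup.relIndex_mul_relIndex _ _ _
    (le_inf (center_le_integralUpToScalars φ) (center_le_stabilizer f)) inf_le_right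

/-- As rationals: `autIndex = #Aut_K/#Aut_R` whenever `#Aut_R(f)` is finite (nonzero).
[cite: BhargavaShankarAnnals2015, §3.2 (published numbering)] -/
theorem autIndex_eq_div (f : BinaryQuartic K) (h : autIntCard φ f ≠ 0) :
    (autIndex φ f : ℚ) = pgl2StabilizerCard f / autIntCard φ f := by
  rw [← autIndex_mul_autIntCard φ f, Nat.cast_mul, mul_div_cancel_right₀ _ (Nat.cast_ne_zero.mpr h)]

/-- `autIndex` is constant on `Kˣ·GL₂(R)`-orbits. [folklore] -/
theorem autIndex_smul {g : GL (Fin 2) K} (hg : g ∈ integralUpToScalars φ) (f : BinaryQuartic K) :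
    autIndex φ (g • f) = autIndex φ f :=
  relIndex_stabilizer_smul_of_mem hg f

/-- `autIndex φ f = 1` iff every `K`-automorphism of `f` comes from `PGL₂(R)`. [folklore] -/
theorem autIndex_eq_one_iff (f : BinaryQuartic K) :
    autIndex φ f = 1 ↔ stabilizer (GL (Fin 2) K) f ≤ integralUpToScalars φ :=
  Subgroup.relIndex_eq_one

/-! ## The weights -/

/-- The `PGL₂(R)`-orbits (= `Kˣ·GL₂(R)`-orbits) in the `PGL₂(K)`-equivalence class of `f` inside
`V_R` — the set of which `B(f)` (resp. `B_p(f)`) is a set of representatives.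
[cite: BhargavaShankarAnnals2015, §3.2 (B(f), B_p(f); published numbering)] -/
def intClassOrbits (f : BinaryQuartic K) : Set (Set (BinaryQuartic K)) :=
  orbitsIn (integralUpToScalars φ) f (integralForms φ)

/-- Unfolding: `O ∈ intClassOrbits φ f` iff `O` is the `Kˣ·GL₂(R)`-orbit of an integral form
`PGL₂(K)`-equivalent to `f`. [folklore] -/
theorem mem_intClassOrbits_iff (f : BinaryQuartic K) (O : Set (BinaryQuartic K)) :
    O ∈ intClassOrbits φ f ↔ ∃ f', (f' ∈ orbit (GL (Fin 2) K) f ∧ f' ∈ integralForms φ) ∧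
      orbit (integralUpToScalars φ) f' = O := Iff.rfl

/-- **Bhargava–Shankar's weight** `Σ_{f' ∈ B(f)} #Aut_K(f')/#Aut_R(f')`: the sum, over the
`PGL₂(R)`-orbits `O` in the `PGL₂(K)`-class of `f` inside `V_R`, of the index `#Aut_K/#Aut_R` of a
representative of `O` (any representative gives the same value, `weight_eq_finsum_of_representatives`;
`∑ᶠ` is `0` if there are infinitely many orbits). For `ℤ ⊂ ℚ` this is `m(f)` (`globalWeight`), for
`ℤ_p ⊂ ℚ_p` it is `m_p(f)` (`localWeight`). [cite: BhargavaShankarAnnals2015, §3.2 (m(f), m_p(f); published numbering)] -/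
def weight (f : BinaryQuartic K) : ℕ :=
  ∑ᶠ O ∈ intClassOrbits φ f, if h : O.Nonempty then autIndex φ h.some else 0

/-- **Independence of the representatives**: for any choice `r O ∈ O` of representatives of the
orbits, `weight φ f = Σ_O #Aut_K(r O)/#Aut_R(r O)`. [cite: BhargavaShankarAnnals2015, §3.2 (published numbering)] -/
theorem weight_eq_finsum_of_representatives (f : BinaryQuartic K) {r : Set (BinaryQuartic K) → BinaryQuartic K}
    (hr : ∀ O ∈ intClassOrbits φ f, r O ∈ O) :
    weight φ f = ∑ᶠ O ∈ intClassOrbits φ f, autIndex φ (r O) := by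
  refine finsum_mem_congr rfl fun O hO ↦ ?_
  obtain ⟨f', -, rfl⟩ := (mem_intClassOrbits_iff φ f O).mp hO
  have hne : (orbit (integralUpToScalars φ) f' : Set (BinaryQuartic K)).Nonempty := ⟨f', mem_orbit_self f'⟩
  rw [dif_pos hne]
  have h1 := relIndex_stabilizer_eq_of_mem_orbitsIn (Γ := integralUpToScalars φ) rfl hne.some_mem
  have h2 := relIndex_stabilizer_eq_of_mem_orbitsIn (Γ := integralUpToScalars φ) rfl (hr _ hO)
  unfold autIndex
  rw [h1, h2]

/-- The cosets `Kˣ·GL₂(R)·g` (`g ∈ GL₂(K)`) with `g · f ∈ V_R`, i.e. the cosets `PGL₂(R) g` of the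
elements `g ∈ PGL₂(K)` carrying `f` to an integral form (as elements `g⁻¹ · Kˣ·GL₂(R)` of Mathlib's
left coset space). [folklore] -/
def cosets (f : BinaryQuartic K) : Set (GL (Fin 2) K ⧸ integralUpToScalars φ) :=
  cosetsOver (integralUpToScalars φ) f (integralForms φ)

/-- Unfolding of `cosets`: `h · Kˣ·GL₂(R) ∈ cosets φ f ↔ h⁻¹ · f ∈ V_R`. [folklore] -/
theorem coe_mem_cosets_iff (f : BinaryQuartic K) (h : GL (Fin 2) K) :
    (h : GL (Fin 2) K ⧸ integralUpToScalars φ) ∈ cosets φ f ↔ h⁻¹ • f ∈ integralForms φ :=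
  mem_cosetsOver_iff (isStableUnder_integralForms φ) h

/-- **`weight φ f` is the number of cosets `PGL₂(R) g` with `g · f ∈ V_R`** (when these are finitely
many): `Σ_{f' ∈ B(f)} #Aut_K(f')/#Aut_R(f') = #(PGL₂(R) \ {g ∈ PGL₂(K) : g · f ∈ V_R})`.
[cite: BhargavaShankarAnnals2015, §3.2 and proof of Prop. 3.6 (published numbering)] -/
theorem weight_eq_ncard_cosets (f : BinaryQuartic K) (hfin : (cosets φ f).Finite) :
    weight φ f = (cosets φ f).ncard := by
  obtain ⟨r, hr⟩ : ∃ r : Set (BinaryQuartic K) → BinaryQuartic K, ∀ O ∈ intClassOrbits φ f, r O ∈ O := by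
    refine ⟨fun O ↦ if h : O.Nonempty then h.some else f, fun O hO ↦ ?_⟩
    obtain ⟨f', -, rfl⟩ := (mem_intClassOrbits_iff φ f O).mp hO
    have h : (orbit (integralUpToScalars φ) f' : Set (BinaryQuartic K)).Nonempty := ⟨f', mem_orbit_self f'⟩
    show (if h : (orbit (integralUpToScalars φ) f' : Set (BinaryQuartic K)).Nonempty then h.some else f) ∈ _
    rw [dif_pos h]; exact h.some_mem
  rw [weight_eq_finsum_of_representatives φ f hr]
  exact (ncard_cosetsOver_eq_finsum_relIndex (isStableUnder_integralForms φ) hfin hr).symm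

/-- `weight φ f ≥ #{PGL₂(R)-orbits in the class of f inside V_R}` (the number `n(f)` of
Bhargava–Shankar, §3.2), the cosets being finitely many. [cite: BhargavaShankarAnnals2015, §3.2 (n(f); published numbering)] -/
theorem ncard_intClassOrbits_le_weight (f : BinaryQuartic K) (hfin : (cosets φ f).Finite) :
    (intClassOrbits φ f).ncard ≤ weight φ f := by
  rw [weight_eq_ncard_cosets φ f hfin]
  exact ncard_orbitsIn_le_ncard_cosetsOver (isStableUnder_integralForms φ) hfin

/-- **`m = n` exactly when the automorphisms are integral**: `weight φ f` equals the number of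
`PGL₂(R)`-orbits in the class of `f` inside `V_R` iff every integral `f'` in the class has
`Aut_K(f') = Aut_R(f')` — in particular when all these `Aut_K(f')` are trivial ("`m(f) = n(f)`
unless some `f' ∈ B(f)` has a nontrivial stabilizer in `PGL₂(ℚ)`", §3.2).
[cite: BhargavaShankarAnnals2015, §3.2 (published numbering)] -/
theorem weight_eq_ncard_intClassOrbits_iff (f : BinaryQuartic K) (hfin : (cosets φ f).Finite) :
    weight φ f = (intClassOrbits φ f).ncard ↔
      ∀ f' ∈ orbit (GL (Fin 2) K) f ∩ integralForms φ,
        stabilizer (GL (Fin 2) K) f' ≤ integralUpToScalars φ := by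
  rw [weight_eq_ncard_cosets φ f hfin]
  exact ncard_cosetsOver_eq_ncard_orbitsIn_iff (isStableUnder_integralForms φ) hfin

/-- If every integral form in the class of `f` has only scalar automorphisms (`#Aut_K(f') = 1`),
then `weight φ f` is the number of `PGL₂(R)`-orbits in the class. [cite: BhargavaShankarAnnals2015, §3.2 (published numbering)] -/
theorem weight_eq_ncard_intClassOrbits_of_stabilizer_le (f : BinaryQuartic K) (hfin : (cosets φ f).Finite)
    (h : ∀ f' ∈ orbit (GL (Fin 2) K) f ∩ integralForms φ, stabilizer (GL (Fin 2) K) f' ≤ Subgroup.center (GL (Fin 2) K)) :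
    weight φ f = (intClassOrbits φ f).ncard :=
  (weight_eq_ncard_intClassOrbits_iff φ f hfin).mpr fun f' hf' ↦
    (h f' hf').trans (center_le_integralUpToScalars φ)

/-- The trivial coset is always there when `f` itself is integral: `1 ≤ weight`. [folklore] -/
theorem one_le_weight {f : BinaryQuartic K} (hf : f ∈ integralForms φ) (hfin : (cosets φ f).Finite) :
    1 ≤ weight φ f := by
  rw [weight_eq_ncard_cosets φ f hfin, Nat.one_le_iff_ne_zero, Ne, Set.ncard_eq_zero hfin]
  refine Set.nonempty_iff_ne_empty.mp ⟨((1 : GL (Fin 2) K) : GL (Fin 2) K ⧸ integralUpToScalars φ), ?_⟩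
  rw [coe_mem_cosets_iff, inv_one, one_smul]
  exact hf

/-- If every `g ∈ GL₂(K)` with `g · f` integral lies in `Kˣ·GL₂(R)`, there is exactly one coset and
`weight φ f = 1` (for integral `f`). [folklore] -/
theorem weight_eq_one_of_forall_mem {f : BinaryQuartic K} (hf : f ∈ integralForms φ)
    (h : ∀ g : GL (Fin 2) K, g • f ∈ integralForms φ → g ∈ integralUpToScalars φ) :
    cosets φ f = {((1 : GL (Fin 2) K) : GL (Fin 2) K ⧸ integralUpToScalars φ)} ∧ weight φ f = 1 := by
  have hcos : cosets φ f = {((1 : GL (Fin 2) K) : GL (Fin 2) K ⧸ integralUpToScalars φ)} := by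
    ext q
    induction q using QuotientGroup.induction_on with
    | H g =>
    rw [coe_mem_cosets_iff, Set.mem_singleton_iff, QuotientGroup.eq, mul_one]
    constructor
    · intro hg
      exact (integralUpToScalars φ).inv_mem_iff.mp (by simpa using h g⁻¹ hg)
    · intro hg
      have : g⁻¹ ∈ integralUpToScalars φ := hg
      exact smul_mem_integralForms φ this hf
  refine ⟨hcos, ?_⟩
  rw [weight_eq_ncard_cosets φ f (by rw [hcos]; exact Set.finite_singleton _), hcos, Set.ncard_singleton]

end Integral

/-! ## `m(f)` and `m_p(f)` -/

/-- **`m(f)`** for `f ∈ V_ℤ` (Bhargava–Shankar, §3.2 of the published version):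
`Σ_{f' ∈ B(f)} #Aut_ℚ(f')/#Aut_ℤ(f')`, `B(f)` representatives of the `PGL₂(ℤ)`-orbits on the
`PGL₂(ℚ)`-class of `f` in `V_ℤ`. [cite: BhargavaShankarAnnals2015, §3.2 (m(f); published numbering)] -/
def globalWeight (f : BinaryQuartic ℤ) : ℕ :=
  weight (Int.castRingHom ℚ) (f.map (Int.castRingHom ℚ))

/-- **`m_p(f)`** for `f ∈ V_{ℤ_p}` (Bhargava–Shankar, §3.2 of the published version):
`Σ_{f' ∈ B_p(f)} #Aut_{ℚ_p}(f')/#Aut_{ℤ_p}(f')`, `B_p(f)` representatives of the `PGL₂(ℤ_p)`-orbits on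
the `PGL₂(ℚ_p)`-class of `f` in `V_{ℤ_p}`. [cite: BhargavaShankarAnnals2015, §3.2 (m_p(f); published numbering)] -/
def localWeight {p : ℕ} [Fact p.Prime] (f : BinaryQuartic ℤ_[p]) : ℕ :=
  weight (PadicInt.Coe.ringHom (p := p)) (f.map PadicInt.Coe.ringHom)

/-- `m_p(f)` for `f ∈ V_ℤ` and a natural number `p`: `localWeight` of the image of `f` in
`V_{ℤ_p}` when `p` is prime, and `1` otherwise (so that products over all `p` are products over the
primes). [cite: BhargavaShankarAnnals2015, §3.2 (m_p(f), f ∈ V_ℤ; published numbering)] -/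
def localWeightAt (p : ℕ) (f : BinaryQuartic ℤ) : ℕ :=
  if hp : p.Prime then (haveI : Fact p.Prime := ⟨hp⟩; localWeight (f.map (Int.castRingHom ℤ_[p]))) else 1

/-- At a prime, `localWeightAt p f = m_p(f)`. [folklore] -/
theorem localWeightAt_of_prime (p : ℕ) [hp : Fact p.Prime] (f : BinaryQuartic ℤ) :
    localWeightAt p f = localWeight (f.map (Int.castRingHom ℤ_[p])) := by
  rw [localWeightAt, dif_pos hp.out]

/-- At a non-prime, `localWeightAt p f = 1`. [folklore] -/
theorem localWeightAt_of_not_prime {p : ℕ} (hp : ¬ p.Prime) (f : BinaryQuartic ℤ) :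
    localWeightAt p f = 1 := by
  rw [localWeightAt, dif_neg hp]

/-- `m(f) ≥ 1`, the orbit of `f` itself contributing (finitely many cosets assumed). [folklore] -/
theorem one_le_globalWeight (f : BinaryQuartic ℤ)
    (hfin : (cosets (Int.castRingHom ℚ) (f.map (Int.castRingHom ℚ))).Finite) : 1 ≤ globalWeight f :=
  one_le_weight _ (map_mem_integralForms _ f) hfin

/-- `m_p(f) ≥ 1` (finitely many cosets assumed). [folklore] -/
theorem one_le_localWeight {p : ℕ} [Fact p.Prime] (f : BinaryQuartic ℤ_[p])
    (hfin : (cosets (PadicInt.Coe.ringHom (p := p)) (f.map PadicInt.Coe.ringHom)).Finite) :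
    1 ≤ localWeight f :=
  one_le_weight _ (map_mem_integralForms _ f) hfin

end BinaryQuartic

end Literature.NumberTheory.EllipticCurves

end
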